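import Mathlib

/-!
# Powers of an `SL(2,ℝ)` monodromy grow at most linearly times `ρ^k` — uniformly through the
# parabolic leaf (solo soloist, blind mode; HOME paper §24.17(8′)(β))

In the sector decomposition of the linearised steady operator (paper §24.17(8′)), the off-band
`m = ±1` and `|m| ≥ 2` components are controlled by the LEAFWISE DAMPED COCYCLE of the carrier:
along the closed streamline `ψ₀ = c` (period `T(c)`) the pressureless amplitude obeys the `2 × 2`
linear ODE `ȧ = -J(x(t)) a`, `tr J = 0`, so its fundamental matrix `Φ_c` has `det = 1`
(Liouville; the frozen-wave-vector version is `cocycle_triple_conserved` in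
`SoloBlindCocycleDet`) and `Φ_c(kT + s) = Φ_c(s) · M(c)^k` with the monodromy `M(c) ∈ SL(2,ℝ)`.
The estimate singled out in §24.17(8′)(β) as "the one estimate in this list that is not textbook"
is the bound `‖Φ_c(t)‖ ≤ C (1 + t) e^{σ(c) t}` with `C` UNIFORM IN THE LEAF `c`, in particular
through the parabolic transition leaf (`|tr M(c)| = 2`), where the Floquet frame degenerates and no
normal-form argument is uniform.

This file shows that the bound is three lines of Cayley–Hamilton, for ANY matrix of determinant
one, with constants depending on nothing but `|tr M|`:

* `pow_succ_eq_chebSeq`: `M^(k+1) = u_{k+1} M − u_k 1` with the Chebyshev-type sequence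
  `u₀ = 0, u₁ = 1, u_{k+2} = τ u_{k+1} − u_k`, `τ = tr M` (`u_k = U_{k-1}(τ/2)`);
* `chebSeq_energy`: the discrete energy `u_{k+1}² − τ u_{k+1} u_k + u_k² = 1` is conserved;
* ELLIPTIC/PARABOLIC leaves `|τ| ≤ 2`: `|u_k| ≤ k` (`abs_chebSeq_le`), and `(4 − τ²) u_k² ≤ 4`
  (`chebSeq_sq_mul_le`, the `k`-uniform bound away from the parabolic point);
* HYPERBOLIC leaves `|τ| = r + r⁻¹`, `r ≥ 1` (so `r = e^{σ T}` is the spectral radius):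
  `0 ≤ u_k ≤ k r^{k-1}` (`chebSeq_hyperbolic_bounds`, via `u_{k+1} = r⁻¹ u_k + r^k`);
* entrywise consequences `|(M^(k+1)) i j| ≤ (k+1)(|M i j| + 1)` (`|τ| ≤ 2`) and
  `≤ (k+1) r^k (|M i j| + 1)` (`|τ| = r + r⁻¹`): `pow_apply_abs_le_of_abs_trace_le_two`,
  `pow_apply_abs_le_of_trace_eq`, `pow_apply_abs_le_of_trace_eq_neg`.

Hence `‖M(c)^k‖ ≤ k ρ(c)^{k-1} (‖M(c)‖ + 1)` on every leaf — hyperbolic, parabolic or elliptic —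
and with `‖Φ_c(s)‖ ≤ e^{L T(c)}` for `s ≤ T(c)` (`L = sup |∇V|`) the cocycle bound
`‖Φ_c(t)‖ ≤ C (1 + t / T_min) e^{σ(c) t}` follows with `C = sup_c (e^{L T(c)} + 1) e^{L T(c)}`,
uniform in `c` with no condition at the transition leaf.  Pure algebra; no analysis.
-/

namespace Summit.AnomalousDissipation.AnomalousDissipation.Theorems

/-- The Chebyshev-type sequence `u₀ = 0`, `u₁ = 1`, `u_{k+2} = τ u_{k+1} − u_k`
(`u_k = U_{k-1}(τ/2)` with `U` the Chebyshev polynomials of the second kind). -/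
def chebSeq (τ : ℝ) : ℕ → ℝ
  | 0 => 0
  | 1 => 1
  | (k + 2) => τ * chebSeq τ (k + 1) - chebSeq τ k

/-- `u₀ = 0`. -/
@[simp] theorem chebSeq_zero (τ : ℝ) : chebSeq τ 0 = 0 := rfl

/-- `u₁ = 1`. -/
@[simp] theorem chebSeq_one (τ : ℝ) : chebSeq τ 1 = 1 := rfl

/-- The recursion `u_{k+2} = τ u_{k+1} − u_k`. -/
theorem chebSeq_add_two (τ : ℝ) (k : ℕ) :
    chebSeq τ (k + 2) = τ * chebSeq τ (k + 1) - chebSeq τ k := rfl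

/-- `u₂ = τ`. -/
@[simp] theorem chebSeq_two (τ : ℝ) : chebSeq τ 2 = τ := by
  rw [chebSeq_add_two]; simp

/-- The discrete energy `u_{k+1}² − τ u_{k+1} u_k + u_k²` is conserved along the recursion and
equals its initial value `1`. -/
theorem chebSeq_energy (τ : ℝ) (k : ℕ) :
    chebSeq τ (k + 1) ^ 2 - τ * chebSeq τ (k + 1) * chebSeq τ k + chebSeq τ k ^ 2 = 1 := by
  induction k with
  | zero => simp
  | succ k ih =>
    rw [show k + 1 + 1 = k + 2 from rfl, chebSeq_add_two]
    linear_combination ih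

/-- Under reflection of `τ` the sequence only changes by alternating signs, so every bound on
`|u_k|` depends on `|τ|` alone. -/
theorem chebSeq_neg (τ : ℝ) (k : ℕ) : chebSeq (-τ) k = (-1) ^ (k + 1) * chebSeq τ k := by
  induction k using Nat.strong_induction_on with
  | _ k ih =>
    match k with
    | 0 => simp
    | 1 => simp
    | (k + 2) =>
      rw [chebSeq_add_two, chebSeq_add_two, ih (k + 1) (by omega), ih k (by omega)]
      ring

/-- `|u_k(−τ)| = |u_k(τ)|`. -/
theorem abs_chebSeq_neg (τ : ℝ) (k : ℕ) : |chebSeq (-τ) k| = |chebSeq τ k| := by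
  rw [chebSeq_neg, abs_mul, abs_pow, abs_neg, abs_one, one_pow, one_mul]

/-- **Elliptic and parabolic leaves.** If `|τ| ≤ 2` then `|u_k| ≤ k`: at most LINEAR growth,
with constant `1`, uniformly up to and including the parabolic point `|τ| = 2` (where `u_k = ±k`
is attained). -/
theorem abs_chebSeq_le {τ : ℝ} (hτ : |τ| ≤ 2) (k : ℕ) : |chebSeq τ k| ≤ k := by
  induction k with
  | zero => simp
  | succ k ih =>
    have hE := chebSeq_energy τ k
    have hτ2 : τ ^ 2 ≤ 4 := by
      have h1 : |τ| ^ 2 ≤ 2 ^ 2 := by gcongr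
      rw [sq_abs] at h1; linarith
    -- completing the square: (2 u_{k+1} - τ u_k)² + (4 - τ²) u_k² = 4
    have hsq : (2 * chebSeq τ (k + 1) - τ * chebSeq τ k) ^ 2 ≤ 4 := by
      have hnn : 0 ≤ (4 - τ ^ 2) * chebSeq τ k ^ 2 := mul_nonneg (by linarith) (sq_nonneg _)
      nlinarith [hE, hnn]
    have h2 : |2 * chebSeq τ (k + 1) - τ * chebSeq τ k| ≤ 2 := by
      rw [abs_le]
      constructor <;>
        nlinarith [hsq, sq_nonneg (2 * chebSeq τ (k + 1) - τ * chebSeq τ k - 2),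
          sq_nonneg (2 * chebSeq τ (k + 1) - τ * chebSeq τ k + 2)]
    -- hence 2|u_{k+1}| ≤ |τ| |u_k| + 2 ≤ 2 |u_k| + 2
    have h3 : 2 * |chebSeq τ (k + 1)| ≤ |τ| * |chebSeq τ k| + 2 := by
      have := abs_sub_abs_le_abs_sub (2 * chebSeq τ (k + 1)) (τ * chebSeq τ k)
      rw [abs_mul, abs_mul, abs_two] at this
      linarith
    have h4 : |τ| * |chebSeq τ k| ≤ 2 * |chebSeq τ k| :=
      mul_le_mul_of_nonneg_right hτ (abs_nonneg _)
    push_cast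
    linarith

/-- The `k`-uniform companion bound on elliptic leaves: `(4 − τ²) u_k² ≤ 4`, i.e.
`|u_k| ≤ 1 / sin θ` for `τ = 2 cos θ` — bounded orbits away from the parabolic point, where the
constant blows up; `abs_chebSeq_le` is what survives the transition. -/
theorem chebSeq_sq_mul_le (τ : ℝ) (k : ℕ) : (4 - τ ^ 2) * chebSeq τ k ^ 2 ≤ 4 := by
  cases k with
  | zero => simp
  | succ k =>
    have hE := chebSeq_energy τ (k + 1)
    -- (2 u_{k+2} - τ u_{k+1})² + (4 - τ²) u_{k+1}² = 4
    nlinarith [hE, sq_nonneg (2 * chebSeq τ (k + 1 + 1) - τ * chebSeq τ (k + 1))]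

/-- **Hyperbolic leaves**, first-order form of the recursion: for `τ = r + r⁻¹` (`r ≠ 0`),
`u_{k+1} − r⁻¹ u_k = r^k`. -/
theorem chebSeq_hyperbolic_step {r : ℝ} (hr : r ≠ 0) (k : ℕ) :
    chebSeq (r + r⁻¹) (k + 1) - r⁻¹ * chebSeq (r + r⁻¹) k = r ^ k := by
  induction k with
  | zero => simp
  | succ k ih =>
    rw [show k + 1 + 1 = k + 2 from rfl, chebSeq_add_two, pow_succ, ← ih]
    field_simp
    ring

/-- **Hyperbolic leaves.** For `τ = r + r⁻¹` with `r ≥ 1` (`r = e^{σT}` the spectral radius of the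
monodromy): `0 ≤ u_k` and `u_{k+1} ≤ (k+1) r^k`, i.e. `|u_k| ≤ k ρ^{k-1}` — linear prefactor,
uniform as `r → 1⁺` (the parabolic transition from the hyperbolic side). -/
theorem chebSeq_hyperbolic_bounds {r : ℝ} (hr : 1 ≤ r) (k : ℕ) :
    0 ≤ chebSeq (r + r⁻¹) k ∧ chebSeq (r + r⁻¹) (k + 1) ≤ (k + 1) * r ^ k := by
  have hr0 : r ≠ 0 := by positivity
  have hrpos : 0 < r := by positivity
  have hrinv : 0 ≤ r⁻¹ := inv_nonneg.mpr hrpos.le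
  have hrinv1 : r⁻¹ ≤ 1 := inv_le_one_of_one_le₀ hr
  induction k with
  | zero => simp
  | succ k ih =>
    obtain ⟨h0, h1⟩ := ih
    have e1 := chebSeq_hyperbolic_step hr0 k
    have e2 := chebSeq_hyperbolic_step hr0 (k + 1)
    have hpk : (0 : ℝ) ≤ r ^ k := by positivity
    have hu1 : 0 ≤ chebSeq (r + r⁻¹) (k + 1) := by nlinarith [mul_nonneg hrinv h0]
    refine ⟨hu1, ?_⟩
    have hpow : r ^ k ≤ r ^ (k + 1) := by
      rw [pow_succ]; nlinarith
    -- u_{k+2} = r⁻¹ u_{k+1} + r^{k+1} ≤ u_{k+1} + r^{k+1} ≤ (k+1) r^k + r^{k+1} ≤ (k+2) r^{k+1}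
    have hstep : chebSeq (r + r⁻¹) (k + 1 + 1) ≤ chebSeq (r + r⁻¹) (k + 1) + r ^ (k + 1) := by
      have : r⁻¹ * chebSeq (r + r⁻¹) (k + 1) ≤ 1 * chebSeq (r + r⁻¹) (k + 1) :=
        mul_le_mul_of_nonneg_right hrinv1 hu1
      linarith
    have hk1 : ((k : ℝ) + 1) * r ^ k ≤ ((k : ℝ) + 1) * r ^ (k + 1) :=
      mul_le_mul_of_nonneg_left hpow (by positivity)
    push_cast
    linarith

/-- Absolute-value form on hyperbolic leaves of either orientation (`τ = ±(r + r⁻¹)`, `r ≥ 1`):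
`|u_{k+1}| ≤ (k+1) r^k`. -/
theorem abs_chebSeq_le_of_abs_eq {τ r : ℝ} (hr : 1 ≤ r) (hτ : |τ| = r + r⁻¹) (k : ℕ) :
    |chebSeq τ (k + 1)| ≤ (k + 1) * r ^ k := by
  have key : ∀ k, |chebSeq (r + r⁻¹) (k + 1)| ≤ (k + 1) * r ^ k := fun k => by
    rw [abs_of_nonneg (chebSeq_hyperbolic_bounds hr (k + 1)).1]
    exact (chebSeq_hyperbolic_bounds hr k).2
  rcases abs_eq_abs.mp (show |τ| = |r + r⁻¹| by
      rw [hτ, abs_of_nonneg (by positivity)]) with h | h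
  · rw [h]; exact key k
  · rw [h, abs_chebSeq_neg]; exact key k

open Matrix

/-- Cayley–Hamilton for a `2 × 2` matrix of determinant one: `M² = (tr M) M − 1`. -/
theorem mul_self_eq_trace_smul_sub_one (M : Matrix (Fin 2) (Fin 2) ℝ) (h : M.det = 1) :
    M * M = M.trace • M - 1 := by
  rw [Matrix.det_fin_two] at h
  ext i j
  fin_cases i <;> fin_cases j <;>
    simp [Matrix.mul_apply, Fin.sum_univ_two, Matrix.trace_fin_two] <;>
    first | linear_combination (-1 : ℝ) * h | ring

/-- **Powers of an `SL(2,ℝ)` matrix.** `M^(k+1) = u_{k+1} M − u_k 1` with `u = chebSeq (tr M)`. -/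
theorem pow_succ_eq_chebSeq (M : Matrix (Fin 2) (Fin 2) ℝ) (h : M.det = 1) (k : ℕ) :
    M ^ (k + 1) = chebSeq M.trace (k + 1) • M - chebSeq M.trace k • (1 : Matrix (Fin 2) (Fin 2) ℝ) := by
  induction k with
  | zero => simp
  | succ k ih =>
    rw [pow_succ, ih, sub_mul, smul_mul_assoc, smul_mul_assoc, one_mul,
      mul_self_eq_trace_smul_sub_one M h, show k + 1 + 1 = k + 2 from rfl, chebSeq_add_two]
    ext i j
    simp [Matrix.sub_apply, Matrix.smul_apply]
    ring

/-- Entrywise form of the power formula. -/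
theorem pow_succ_apply_eq (M : Matrix (Fin 2) (Fin 2) ℝ) (h : M.det = 1) (k : ℕ) (i j : Fin 2) :
    (M ^ (k + 1)) i j =
      chebSeq M.trace (k + 1) * M i j - chebSeq M.trace k * (1 : Matrix (Fin 2) (Fin 2) ℝ) i j := by
  rw [pow_succ_eq_chebSeq M h k]
  simp [Matrix.sub_apply, Matrix.smul_apply]

/-- **Uniform power bound, elliptic and parabolic monodromies** (`|tr M| ≤ 2`): every entry of
`M^(k+1)` is at most `(k+1) (|M i j| + 1)` in absolute value — linear growth, constant `1`,
no condition at `|tr M| = 2`. -/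
theorem pow_apply_abs_le_of_abs_trace_le_two (M : Matrix (Fin 2) (Fin 2) ℝ) (h : M.det = 1)
    (hτ : |M.trace| ≤ 2) (k : ℕ) (i j : Fin 2) :
    |(M ^ (k + 1)) i j| ≤ (k + 1) * (|M i j| + 1) := by
  rw [pow_succ_apply_eq M h k i j]
  have h1 := abs_chebSeq_le hτ (k + 1)
  have h0 := abs_chebSeq_le hτ k
  have hone : |(1 : Matrix (Fin 2) (Fin 2) ℝ) i j| ≤ 1 := by
    rw [Matrix.one_apply]; split_ifs <;> simp
  calc |chebSeq M.trace (k + 1) * M i j - chebSeq M.trace k * (1 : Matrix (Fin 2) (Fin 2) ℝ) i j|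
      ≤ |chebSeq M.trace (k + 1) * M i j| + |chebSeq M.trace k * (1 : Matrix (Fin 2) (Fin 2) ℝ) i j| :=
        abs_sub _ _
    _ = |chebSeq M.trace (k + 1)| * |M i j| + |chebSeq M.trace k| * |(1 : Matrix (Fin 2) (Fin 2) ℝ) i j| := by
        rw [abs_mul, abs_mul]
    _ ≤ (k + 1) * |M i j| + k * 1 := by
        gcongr
        · exact_mod_cast h1
    _ ≤ (k + 1) * (|M i j| + 1) := by nlinarith [abs_nonneg (M i j)]

/-- **Uniform power bound, hyperbolic monodromies** (`tr M = r + r⁻¹`, `r ≥ 1`, `r = ρ(M)`):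
every entry of `M^(k+1)` is at most `(k+1) r^k (|M i j| + 1)` in absolute value — the linear
prefactor is uniform as `r → 1`, so the bound passes continuously to the parabolic case. -/
theorem pow_apply_abs_le_of_abs_trace_eq (M : Matrix (Fin 2) (Fin 2) ℝ) (h : M.det = 1)
    {r : ℝ} (hr : 1 ≤ r) (hτ : |M.trace| = r + r⁻¹) (k : ℕ) (i j : Fin 2) :
    |(M ^ (k + 1)) i j| ≤ (k + 1) * r ^ k * (|M i j| + 1) := by
  rw [pow_succ_apply_eq M h k i j]
  have h1 : |chebSeq M.trace (k + 1)| ≤ (k + 1) * r ^ k := abs_chebSeq_le_of_abs_eq hr hτ k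
  have h0 : |chebSeq M.trace k| ≤ (k + 1) * r ^ k := by
    cases k with
    | zero => simp
    | succ k =>
      have := abs_chebSeq_le_of_abs_eq hr hτ k
      have hpow : r ^ k ≤ r ^ (k + 1) := by
        rw [pow_succ]; nlinarith [pow_pos (show (0:ℝ) < r by positivity) k]
      push_cast at this ⊢
      nlinarith [pow_pos (show (0:ℝ) < r by positivity) k]
  have hone : |(1 : Matrix (Fin 2) (Fin 2) ℝ) i j| ≤ 1 := by
    rw [Matrix.one_apply]; split_ifs <;> simp
  have hrk : (0 : ℝ) ≤ (k + 1) * r ^ k := by positivity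
  calc |chebSeq M.trace (k + 1) * M i j - chebSeq M.trace k * (1 : Matrix (Fin 2) (Fin 2) ℝ) i j|
      ≤ |chebSeq M.trace (k + 1) * M i j| + |chebSeq M.trace k * (1 : Matrix (Fin 2) (Fin 2) ℝ) i j| :=
        abs_sub _ _
    _ = |chebSeq M.trace (k + 1)| * |M i j| + |chebSeq M.trace k| * |(1 : Matrix (Fin 2) (Fin 2) ℝ) i j| := by
        rw [abs_mul, abs_mul]
    _ ≤ (k + 1) * r ^ k * |M i j| + (k + 1) * r ^ k * 1 := by
        gcongr
    _ = (k + 1) * r ^ k * (|M i j| + 1) := by ring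

/-- Every real `τ` with `|τ| ≥ 2` is `r + r⁻¹` for `r = (|τ| + √(τ² − 4))/2 ≥ 1` — so the two
bounds above cover every matrix of determinant one. -/
theorem exists_radius_of_two_le_abs {τ : ℝ} (hτ : 2 ≤ |τ|) :
    ∃ r : ℝ, 1 ≤ r ∧ |τ| = r + r⁻¹ := by
  set s := Real.sqrt (τ ^ 2 - 4) with hs_def
  have hs0 : 0 ≤ s := Real.sqrt_nonneg _
  have hτ2 : 0 ≤ τ ^ 2 - 4 := by
    have h22 : (2:ℝ) ^ 2 ≤ |τ| ^ 2 := by gcongr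
    rw [sq_abs] at h22; linarith
  have hss : s * s = τ ^ 2 - 4 := Real.mul_self_sqrt hτ2
  refine ⟨(|τ| + s) / 2, by linarith, ?_⟩
  have habs : |τ| * |τ| = τ ^ 2 := by rw [← sq, sq_abs]
  have hprod : (|τ| + s) / 2 * ((|τ| - s) / 2) = 1 := by
    linear_combination (1/4 : ℝ) * habs - (1/4 : ℝ) * hss
  rw [inv_eq_of_mul_eq_one_right hprod]
  ring

end Summit.AnomalousDissipation.AnomalousDissipation.Theorems
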